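import Summits.QuantumFields.YangMills.Theorems.BalabanLadderNTMarkovMirrorDefectFBL6
import Summits.QuantumFields.YangMills.Theorems.BalabanLadderNTMarkovMirrorAffinePackage
import Summits.QuantumFields.YangMills.Theorems.BalabanLadderNTBoundaryLawCentred
import Mathlib.Probability.Moments.Variance
import HarnessLib

/-!
# Crux `UVSeamRec` (stmt-QuantumFields-20043), stub `stub_floorsEngine` (S-B) / crux `NT` clause (i):
# the chirality-defect input in the MEASURE-TYPICAL currency, fed by centred-cube RESPONSE MOMENTS

Helper file (`--supports stmt-QuantumFields-20043`) of the seam stub-prover row `ym-20043-seam-s1` (owner RULINGS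
R75 / R87), sequel of `…NTMarkovMirrorDefect` (p510134: the exact defect-response identity), `…DefectFBL6` (p510874:
the sup bound `O(aβ)` from a `∀`-exterior plane law) and `…BareTypicalPackage` (p520967: the clause-(i) package
{MF, RBLΔ-L²}).  General compact `G`, any lattice representation `r`; nothing here is `SU(2)`-specific.

WHY.  In the (S-B) residual of record {BL6, MF, clause (ii)} (R87 (1)) the plane-resolved boundary law BL6 is a
`∀`-exterior one-point law with depth-decaying tolerance — the species the fleet lead's kit finding (ym-spine-20043-p1
g7, evidence #50) leaves SUSPECT.  The Markov–mirror argument never needs it: the defect enters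
`Q2_ge_of_bareFloor_l2` only through its MEAN SQUARE under Wilson's torus measure (RBLΔ-L²).  This file supplies
(RBLΔ-L²) from TYPICAL one-point data, in particular from singleton exponential RESPONSE MOMENTS of centred cubes —
the `n = 1` case of the law (RM) the v5(α) skeleton of `UVSeamRec` already owes for its ceilings stub
(`stub_responseMomentsOdd6`, press-button p532738); the packaging along a unit map is the sequel
`…NTMarkovMirrorDefectResponseMoments`.

* §1 tools: `torusE_mono`, `torusE_finset_sum`, `kerE_sub_const`, **`sq_kerE_le_kerE_sq`** (conditional Jensen in a
  cube kernel), `torusE_kerE_eq_of_collarWindow` (one-cube torus DLR step for observables in the collar window);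
* §2 **`torusE_sq_kerE_le_of_nested`** — mean-square one-point deviations of cube-kernel means are ANTITONE under
  nesting (DLR tower `BoundaryLaw.kerE_kerE_of_subset` + conditional Jensen + torus DLR): the typical twin of
  `BoundaryLaw.abs_kerE_sub_le_of_subset`;
* §3 `torusE_sq_le_of_expMoment` (`E_T[exp(λ|Φ|)] ≤ e^B ⇒ E_T[Φ²] ≤ 2e^B/λ²`);
* §4 **`defect_response_sq_le`** — the typical twin of `defect_response_le`: per-site MEAN-SQUARE plane laws `≤ h²` on
  the thickened support give `E_T[(kerE_Q(Wᴿ) − kerE_Q(Ṽ) − p')²] ≤ (N·K·6h)²` (exact identity `defect_response_eq`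
  + Cauchy–Schwarz over the `≤ 6N` terms).

Honest status: kernel-checked implications on a CONDITIONAL chain; (RM) is an OPEN RG statement (E0′-K with
background), MF and clause (ii) are crux `NT`'s open mathematics (barrier `PerturbativeInvisibility`).  Refs: Georgii
2011, Def. 1.23 (iii) / Thm. 4.17 (consistency, torus DLR); card E `Cruxes/NT/Ideas/markov-mirror-dirichlet-response.md`.
-/

set_option autoImplicit false

noncomputable section

open scoped SchwartzMap
open MeasureTheory ProbabilityTheory Filter Topology
open Literature.MathematicalPhysics.QuantumFieldTheory Literature.MathematicalPhysics.QuantumLattice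
open Literature.Probability.LatticeModels
open Summit.QuantumFields.YangMills.Cruxes.OSLegsFromFemtoAndGap.DlrCollarTransfer
open Summit.QuantumFields.YangMills.Cruxes.OSLegsFromFemtoAndGap.DlrCollarTransfer.StubLower (mem_cubeSites_iff)
open Summit.QuantumFields.YangMills.Theorems.OSLegsFromFemtoAndGap.StubLower
  (integrable_of_continuous_compact integral_torusLift_eq_integral_kernel)
open Summit.QuantumFields.YangMills.Cruxes.OSLegsAtWeakCouplingC.InheritedAmplitudeGates.StubInherit
  (integrable_lift plane_supp_window window_of_depth_pos)
open Summit.QuantumFields.YangMills.Cruxes.NT.Reference (continuous_kerE eventually_le_of_tendsto div_pow_depth_le)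
open Summit.QuantumFields.YangMills.Cruxes.NT.BoundaryLaw
  (abs_kerE_le kerE_kerE_of_subset cubeSites_subset cubeEdges_subset window_of_succ_le_depth)
open Summit.QuantumFields.YangMills.Cruxes.UVSeamRec.UnitTransfer (exists_radius)

namespace Summit.QuantumFields.YangMills.Cruxes.NT.MarkovMirror

/-! ## §1 Tools: monotonicity, conditional Jensen, the DLR step on the collar window -/

section Tools

variable (G : Type) [Group G] [TopologicalSpace G] [IsTopologicalGroup G] [CompactSpace G]
  [MeasurableSpace G] [BorelSpace G] (r : LatticeRep G)

/-- Torus expectations of continuous observables are monotone. [folklore] -/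
theorem torusE_mono (β : ℝ) (L : ℕ) {A B : LGConfig 4 G → ℝ} (hA : Continuous A) (hB : Continuous B)
    (h : ∀ V, A V ≤ B V) : torusE G r β L A ≤ torusE G r β L B := by
  unfold torusE
  exact integral_mono (integrable_lift G r β hA) (integrable_lift G r β hB) fun U => h _

/-- Torus expectation of a finite sum of continuous observables. [folklore] -/
theorem torusE_finset_sum (β : ℝ) (L : ℕ) {ι : Type*} (S : Finset ι) (F : ι → LGConfig 4 G → ℝ)
    (hF : ∀ i ∈ S, Continuous (F i)) :
    torusE G r β L (fun V => ∑ i ∈ S, F i V) = ∑ i ∈ S, torusE G r β L (F i) := by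
  have h := torusE_sum_mul G r β L S (fun _ => (1 : ℝ)) F hF
  simp only [one_mul] at h
  exact h

/-- Cube-kernel mean of an observable shifted by a constant. [folklore] -/
theorem kerE_sub_const (β : ℝ) (c : Fin 4 → ℤ) (b : ℕ) (η : LGConfig 4 G) {F : LGConfig 4 G → ℝ}
    (hF : Continuous F) (p : ℝ) : kerE G r β c b η (fun U => F U - p) = kerE G r β c b η F - p := by
  haveI := r.secondCountableTopology
  haveI := isProbabilityMeasure_ymSpecification r.ρ r.continuous β (cubeEdges c b) η
  unfold kerE
  rw [integral_sub (integrable_of_continuous_compact hF) (integrable_const p), integral_const, smul_eq_mul,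
    probReal_univ, one_mul]

/-- **Conditional Jensen in a cube kernel.**  For a bounded measurable `g` and every exterior `η`:
`(kerE_Q^η g)² ≤ kerE_Q^η (g²)` (the kernel is a probability measure; variance is non-negative). [folklore] -/
theorem sq_kerE_le_kerE_sq (β : ℝ) (c : Fin 4 → ℤ) (b : ℕ) (η : LGConfig 4 G) {g : LGConfig 4 G → ℝ}
    (hg : Measurable g) {M : ℝ} (hM : ∀ U, |g U| ≤ M) :
    (kerE G r β c b η g) ^ 2 ≤ kerE G r β c b η (fun U => g U ^ 2) := by
  haveI := r.secondCountableTopology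
  haveI := isProbabilityMeasure_ymSpecification r.ρ r.continuous β (cubeEdges c b) η
  have hX : MemLp g 2 (ymSpecification (d := 4) r.ρ β (cubeEdges c b) η) :=
    MemLp.of_bound hg.aestronglyMeasurable M (ae_of_all _ fun U => by rw [Real.norm_eq_abs]; exact hM U)
  have hv := variance_nonneg g (ymSpecification (d := 4) r.ρ β (cubeEdges c b) η)
  rw [variance_eq_sub hX] at hv
  simp only [Pi.pow_apply] at hv
  unfold kerE
  linarith

/-- **One-cube torus DLR step, collar-window form.**  For a bounded continuous cylinder observable `H` whose links
are based in the collar window `[c − 1, c + b]` of the cube `Q = (c, b)` and a torus `2L+1 ≥ b + 4`: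
`E_T[kerE_Q^{lift U}(H)] = E_T[H∘lift]` (`integral_torusLift_eq_integral_kernel`, window `lo = c − 2`). [folklore] -/
theorem torusE_kerE_eq_of_collarWindow (β : ℝ) (c : Fin 4 → ℤ) (b L : ℕ) (hL : b + 4 ≤ 2 * L + 1)
    {H : LGConfig 4 G → ℝ} (hH : Continuous H) {C : ℝ} (hC : ∀ U, |H U| ≤ C)
    {S₀ : Finset (Literature.MathematicalPhysics.QuantumLattice.ZdEdge 4)} (hHS : IsCylinder H S₀)
    (hS₀ : ∀ e ∈ S₀, ∀ j, c j - 1 ≤ e.1 j ∧ e.1 j ≤ c j + b) :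
    torusE G r β L (fun V => kerE G r β c b V H) = torusE G r β L H := by
  haveI := r.secondCountableTopology
  unfold torusE kerE
  symm
  refine integral_torusLift_eq_integral_kernel r.ρ r.continuous β (cubeEdges c b) hH hC hHS (2 * L + 1)
    (fun j => c j - 2) fun e he j => ?_
  have hL' : (b : ℤ) + 4 ≤ 2 * (L : ℤ) + 1 := by exact_mod_cast hL
  rcases Finset.mem_union.1 he with h1 | h2
  · have := cubeEdges_fst_window h1 j
    push_cast
    constructor <;> linarith [this.1, this.2]
  · have := hS₀ e h2 j
    push_cast
    constructor <;> linarith [this.1, this.2]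

end Tools

/-! ## §2 Mean-square one-point deviations are antitone under nesting -/

section Nested

variable (G : Type) [Group G] [TopologicalSpace G] [IsTopologicalGroup G] [CompactSpace G]
  [MeasurableSpace G] [BorelSpace G] (r : LatticeRep G)

/-- **Typical one-point laws pass from sub-cubes to cubes.**  Let `Q' = (c', b')` be a sub-cube of `Q = (c, b)` at
depth `≥ 1` (`c + 1 ≤ c'`, `c' + b' + 1 ≤ c + b` coordinatewise), `F` a bounded continuous cylinder observable with
links based in `[c', c' + b']`, `p` a reference value, and `2L+1 ≥ b + 4`.  Then
`E_T[(kerE_Q^{lift U}(F) − p)²] ≤ E_T[(kerE_{Q'}^{lift U}(F) − p)²]`.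
Proof: `kerE_Q(F − p) = kerE_Q(kerE_{Q'}(F − p))` (consistency), `(kerE_Q g)² ≤ kerE_Q(g²)` (conditional Jensen),
and `E_T[kerE_Q(g²)∘lift] = E_T[g²∘lift]` (torus DLR for `Q`; `g = kerE_{Q'}(F − p)` reads only links in the collar
window of `Q'`, inside the window of `Q`).  The typical twin of `BoundaryLaw.abs_kerE_sub_le_of_subset`. [folklore] -/
theorem torusE_sq_kerE_le_of_nested (β : ℝ) {c c' : Fin 4 → ℤ} {b b' : ℕ}
    (hwin : ∀ j, c j + 1 ≤ c' j ∧ c' j + (b' : ℤ) + 1 ≤ c j + b) (L : ℕ) (hL : b + 4 ≤ 2 * L + 1)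
    {F : LGConfig 4 G → ℝ} (hF : Continuous F) {M : ℝ} (hM : ∀ U, |F U| ≤ M)
    {S : Finset (Literature.MathematicalPhysics.QuantumLattice.ZdEdge 4)} (hFS : IsCylinder F S)
    (hS : ∀ e ∈ S, ∀ j, c' j ≤ e.1 j ∧ e.1 j ≤ c' j + b') (p : ℝ) :
    torusE G r β L (fun V => (kerE G r β c b V F - p) ^ 2) ≤
      torusE G r β L (fun V => (kerE G r β c' b' V F - p) ^ 2) := by
  haveI := r.secondCountableTopology
  have hsub : cubeEdges c' b' ⊆ cubeEdges c b :=
    cubeEdges_subset (cubeSites_subset fun j => ⟨by linarith [(hwin j).1], by linarith [(hwin j).2]⟩)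
  -- the centred observable and its sub-cube kernel mean
  have hfc : Continuous fun U => F U - p := hF.sub continuous_const
  have hfb : ∀ U, |F U - p| ≤ M + |p| := fun U => (abs_sub _ _).trans (by linarith [hM U])
  have hgc : Continuous fun U => kerE G r β c' b' U (fun U => F U - p) := continuous_kerE G r β c' b' hfc hfb
  have hgb : ∀ U, |kerE G r β c' b' U (fun U => F U - p)| ≤ M + |p| := fun U => abs_kerE_le G r β c' b' U hfb
  have hg2c : Continuous fun U => kerE G r β c' b' U (fun U => F U - p) ^ 2 := hgc.pow 2
  have hg2b : ∀ U, |kerE G r β c' b' U (fun U => F U - p) ^ 2| ≤ (M + |p|) ^ 2 := fun U => by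
    rw [abs_pow]; exact pow_le_pow_left₀ (abs_nonneg _) (hgb U) 2
  -- support of `g²`: the collar window of `Q'`, inside `[c, c + b − 1] ⊆ [c − 1, c + b]`
  have hgS : IsCylinder (fun U => kerE G r β c' b' U (fun U => F U - p) ^ 2)
      (S ∪ (plaquettesTouching (cubeEdges c' b')).biUnion plaquetteEdges) := by
    have h1 : IsCylinder (fun U => kerE G r β c' b' U (fun U => F U - p))
        (S ∪ (plaquettesTouching (cubeEdges c' b')).biUnion plaquetteEdges) :=
      isCylinder_kerE G r β c' b' hfc.measurable (fun U V hUV => by simp only [hFS hUV])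
    exact fun U V hUV => by simp only [h1 hUV]
  have hgSwin : ∀ e ∈ S ∪ (plaquettesTouching (cubeEdges c' b')).biUnion plaquetteEdges, ∀ j,
      c j - 1 ≤ e.1 j ∧ e.1 j ≤ c j + b := fun e he j => by
    have h := kerE_supp_window hS he j
    constructor <;> linarith [h.1, h.2, (hwin j).1, (hwin j).2]
  -- (1) consistency + (2) conditional Jensen, pointwise in the exterior
  have hpt : ∀ V : LGConfig 4 G, (kerE G r β c b V F - p) ^ 2 ≤
      kerE G r β c b V (fun U => kerE G r β c' b' U (fun U => F U - p) ^ 2) := by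
    intro V
    rw [← kerE_sub_const G r β c b V hF p, ← kerE_kerE_of_subset G r β hsub V hfc.measurable hfb]
    exact sq_kerE_le_kerE_sq G r β c b V hgc.measurable hgb
  -- (3) integrate and apply the torus DLR step for `Q`
  have hmono := torusE_mono G r β L ((continuous_kerE G r β c b hF hM).sub continuous_const |>.pow 2)
    (continuous_kerE G r β c b hg2c hg2b) hpt
  rw [torusE_kerE_eq_of_collarWindow G r β c b L hL hg2c hg2b hgS hgSwin] at hmono
  refine hmono.trans (le_of_eq ?_)
  congr 1
  funext V
  rw [kerE_sub_const G r β c' b' V hF p]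

end Nested

/-! ## §3 Exponential response moments feed mean squares -/

section ExpMoment

variable (G : Type) [Group G] [TopologicalSpace G] [IsTopologicalGroup G] [CompactSpace G]
  [MeasurableSpace G] [BorelSpace G] (r : LatticeRep G)

/-- **An exponential moment bounds the mean square.**  For a continuous `Φ` and `λ > 0`:
`E_T[exp(λ|Φ|)] ≤ e^B ⇒ E_T[Φ²] ≤ 2e^B/λ²` (pointwise `t² ≤ 2eᵗ` for `t ≥ 0`). [folklore] -/
theorem torusE_sq_le_of_expMoment (β : ℝ) (L : ℕ) {Φ : LGConfig 4 G → ℝ} (hΦ : Continuous Φ) {lam B : ℝ}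
    (hlam : 0 < lam) (h : torusE G r β L (fun V => Real.exp (lam * |Φ V|)) ≤ Real.exp B) :
    torusE G r β L (fun V => Φ V ^ 2) ≤ 2 * Real.exp B / lam ^ 2 := by
  have hpt : ∀ V, Φ V ^ 2 ≤ 2 / lam ^ 2 * Real.exp (lam * |Φ V|) := fun V => by
    have ht : 0 ≤ lam * |Φ V| := by positivity
    have hq := Real.quadratic_le_exp_of_nonneg ht
    have h2 : (lam * |Φ V|) ^ 2 ≤ 2 * Real.exp (lam * |Φ V|) := by nlinarith
    rw [mul_pow, sq_abs] at h2
    rw [div_mul_eq_mul_div, le_div_iff₀ (by positivity)]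
    linarith
  have hec : Continuous fun V => Real.exp (lam * |Φ V|) := Real.continuous_exp.comp (continuous_const.mul hΦ.abs)
  have hmono := torusE_mono G r β L (A := fun V => Φ V ^ 2) (B := fun V => 2 / lam ^ 2 * Real.exp (lam * |Φ V|))
    (hΦ.pow 2) (continuous_const.mul hec) hpt
  rw [torusE_const_mul] at hmono
  calc torusE G r β L (fun V => Φ V ^ 2) ≤ 2 / lam ^ 2 * torusE G r β L (fun V => Real.exp (lam * |Φ V|)) := hmono
    _ ≤ 2 / lam ^ 2 * Real.exp B := mul_le_mul_of_nonneg_left h (by positivity)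
    _ = 2 * Real.exp B / lam ^ 2 := by ring

end ExpMoment

/-! ## §4 The chirality-defect response in mean square -/

section DefectSq

variable (G : Type) [Group G] [TopologicalSpace G] [IsTopologicalGroup G] [CompactSpace G]
  [MeasurableSpace G] [BorelSpace G] (r : LatticeRep G)

/-- **The defect response is small in MEAN SQUARE under per-site mean-square plane laws** — the typical twin of
`defect_response_le`.  With the notation of `defect_response_eq`, reference values `p_q` and
`p' := ∑_x [v(s·(x+e₀)) − v(s·x)] ∑_q [q electric] p_q`: if on the torus `2L+1`
`E_T[(kerE_Q^{lift U}(plane_q x) − p_q)²] ≤ h²` for every electric `q` at every site `x ∈ Q` where `v(s·x) ≠ 0` or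
`v(s·(x+e₀)) ≠ 0`, the increments obey `|v(s·(x+e₀)) − v(s·x)| ≤ K`, and there are at most `N` such sites, then
`E_T[(kerE_Q^{lift U}(Wᴿ) − kerE_Q^{lift U}(Ṽ) − p')²] ≤ (N · (K · (6 h)))²` (the exact identity pointwise in the
exterior, Cauchy–Schwarz over the `≤ 6N` terms, linearity of `E_T`). [folklore] -/
theorem defect_response_sq_le (β : ℝ) (c : Fin 4 → ℤ) (b L : ℕ) (s : ℝ) (v : 𝓢(EuclideanSpace ℝ (Fin 4), ℝ))
    (hsupp : ∀ x : Fin 4 → ℤ, v (s • siteToE x) ≠ 0 → x ∈ cubeSites c b ∧ 2 ≤ depth c b x)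
    (pq : {q : Fin 4 × Fin 4 // q.1 < q.2} → ℝ) {h K : ℝ} (hh : 0 ≤ h)
    (hBL2 : ∀ q : {q : Fin 4 × Fin 4 // q.1 < q.2}, q.1.1 = 0 → ∀ x ∈ cubeSites c b,
      (v (s • siteToE x) ≠ 0 ∨ v (s • siteToE (x + Pi.single 0 1)) ≠ 0) →
        torusE G r β L (fun V => (kerE G r β c b V (plane G r q.1 x) - pq q) ^ 2) ≤ h ^ 2)
    (hLip : ∀ x : Fin 4 → ℤ, |v (s • siteToE (x + Pi.single 0 1)) - v (s • siteToE x)| ≤ K)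
    (N : ℕ) (hN : ((cubeSites c b).filter fun x =>
      v (s • siteToE x) ≠ 0 ∨ v (s • siteToE (x + Pi.single 0 1)) ≠ 0).card ≤ N) :
    torusE G r β L (fun V => (kerE G r β c b V (fun V => ∑ x ∈ cubeSites c b, v (s • siteToE x) *
          ∑ q : {q : Fin 4 × Fin 4 // q.1 < q.2}, plane G r q.1 (if q.1.1 = 0 then x - Pi.single 0 1 else x) V) -
        kerE G r β c b V (fun V => ∑ y ∈ cubeSites c b, v (s • siteToE y) * dens G r y V) -
        ∑ x ∈ cubeSites c b, (v (s • siteToE (x + Pi.single 0 1)) - v (s • siteToE x)) *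
          ∑ q : {q : Fin 4 × Fin 4 // q.1 < q.2}, (if q.1.1 = 0 then pq q else 0)) ^ 2) ≤
      (N * (K * (6 * h))) ^ 2 := by
  classical
  obtain ⟨CA, hCA⟩ := exists_abs_plane_le r
  set T := (cubeSites c b).filter fun x =>
    v (s • siteToE x) ≠ 0 ∨ v (s • siteToE (x + Pi.single 0 1)) ≠ 0 with hT
  -- the centred responses, electric orientations kept
  set e : {q : Fin 4 × Fin 4 // q.1 < q.2} → (Fin 4 → ℤ) → LGConfig 4 G → ℝ := fun q x V =>
    if q.1.1 = 0 then kerE G r β c b V (plane G r q.1 x) - pq q else 0 with he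
  have hcard6 : (Fintype.card {q : Fin 4 × Fin 4 // q.1 < q.2} : ℝ) = 6 := by
    have : Fintype.card {q : Fin 4 × Fin 4 // q.1 < q.2} = 6 := by decide
    rw [this]; norm_num
  have hec : ∀ (q : {q : Fin 4 × Fin 4 // q.1 < q.2}) (x : Fin 4 → ℤ), Continuous fun V => e q x V := by
    intro q x
    by_cases hq : q.1.1 = 0
    · have hfun : (fun V => e q x V) = fun V => kerE G r β c b V (plane G r q.1 x) - pq q := by
        funext V; simp only [he]; rw [if_pos hq]
      rw [hfun]
      exact (continuous_kerE G r β c b (continuous_plane r q.1 x) (hCA q.1 x)).sub continuous_const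
    · have hfun : (fun V => e q x V) = fun _ => (0 : ℝ) := by
        funext V; simp only [he]; rw [if_neg hq]
      rw [hfun]
      exact continuous_const
  -- (1) the defect minus its reference value, as a sum over the thickened support (pointwise in the exterior)
  have hD : ∀ V : LGConfig 4 G,
      kerE G r β c b V (fun V => ∑ x ∈ cubeSites c b, v (s • siteToE x) *
          ∑ q : {q : Fin 4 × Fin 4 // q.1 < q.2}, plane G r q.1 (if q.1.1 = 0 then x - Pi.single 0 1 else x) V) -
        kerE G r β c b V (fun V => ∑ y ∈ cubeSites c b, v (s • siteToE y) * dens G r y V) -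
        ∑ x ∈ cubeSites c b, (v (s • siteToE (x + Pi.single 0 1)) - v (s • siteToE x)) *
          ∑ q : {q : Fin 4 × Fin 4 // q.1 < q.2}, (if q.1.1 = 0 then pq q else 0) =
      ∑ x ∈ T, (v (s • siteToE (x + Pi.single 0 1)) - v (s • siteToE x)) *
        ∑ q : {q : Fin 4 × Fin 4 // q.1 < q.2}, e q x V := by
    intro V
    rw [defect_response_eq G r β c b s v hsupp V, ← Finset.sum_sub_distrib]
    have hterm : ∀ x ∈ cubeSites c b,
        (v (s • siteToE (x + Pi.single 0 1)) - v (s • siteToE x)) *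
            ∑ q : {q : Fin 4 × Fin 4 // q.1 < q.2},
              (if q.1.1 = 0 then kerE G r β c b V (plane G r q.1 x) else 0) -
          (v (s • siteToE (x + Pi.single 0 1)) - v (s • siteToE x)) *
            ∑ q : {q : Fin 4 × Fin 4 // q.1 < q.2}, (if q.1.1 = 0 then pq q else 0) =
        (v (s • siteToE (x + Pi.single 0 1)) - v (s • siteToE x)) *
          ∑ q : {q : Fin 4 × Fin 4 // q.1 < q.2}, e q x V := by
      intro x _
      rw [← mul_sub, ← Finset.sum_sub_distrib]
      congr 1
      refine Finset.sum_congr rfl fun q _ => ?_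
      simp only [he]
      split_ifs <;> ring
    rw [Finset.sum_congr rfl hterm, ← Finset.sum_filter_add_sum_filter_not (cubeSites c b)
      (fun x => v (s • siteToE x) ≠ 0 ∨ v (s • siteToE (x + Pi.single 0 1)) ≠ 0)]
    have hzero : ∑ x ∈ (cubeSites c b).filter
        (fun x => ¬(v (s • siteToE x) ≠ 0 ∨ v (s • siteToE (x + Pi.single 0 1)) ≠ 0)),
        (v (s • siteToE (x + Pi.single 0 1)) - v (s • siteToE x)) *
          ∑ q : {q : Fin 4 × Fin 4 // q.1 < q.2}, e q x V = 0 := by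
      refine Finset.sum_eq_zero fun x hx => ?_
      obtain ⟨-, hx⟩ := Finset.mem_filter.1 hx
      push Not at hx
      rw [hx.1, hx.2, sub_zero, zero_mul]
    rw [hzero, add_zero]
  -- (2) pointwise Cauchy–Schwarz: `D² ≤ 6·#T·K²·Σ_{x∈T} Σ_q e²`
  have hpt : ∀ V : LGConfig 4 G,
      (∑ x ∈ T, (v (s • siteToE (x + Pi.single 0 1)) - v (s • siteToE x)) *
        ∑ q : {q : Fin 4 × Fin 4 // q.1 < q.2}, e q x V) ^ 2 ≤
      6 * T.card * K ^ 2 * ∑ x ∈ T, ∑ q : {q : Fin 4 × Fin 4 // q.1 < q.2}, e q x V ^ 2 := by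
    intro V
    have h1 := sq_sum_le_card_mul_sum_sq (s := T)
      (f := fun x => (v (s • siteToE (x + Pi.single 0 1)) - v (s • siteToE x)) *
        ∑ q : {q : Fin 4 × Fin 4 // q.1 < q.2}, e q x V)
    refine h1.trans ?_
    rw [Finset.mul_sum, Finset.mul_sum]
    refine Finset.sum_le_sum fun x _ => ?_
    have h2 := sq_sum_le_card_mul_sum_sq (s := (Finset.univ : Finset {q : Fin 4 × Fin 4 // q.1 < q.2}))
      (f := fun q => e q x V)
    rw [Finset.card_univ, hcard6] at h2
    have hΔ : (v (s • siteToE (x + Pi.single 0 1)) - v (s • siteToE x)) ^ 2 ≤ K ^ 2 := by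
      rw [← sq_abs]; exact pow_le_pow_left₀ (abs_nonneg _) (hLip x) 2
    calc (T.card : ℝ) * (((v (s • siteToE (x + Pi.single 0 1)) - v (s • siteToE x)) *
          ∑ q : {q : Fin 4 × Fin 4 // q.1 < q.2}, e q x V) ^ 2)
        = T.card * ((v (s • siteToE (x + Pi.single 0 1)) - v (s • siteToE x)) ^ 2 *
          (∑ q : {q : Fin 4 × Fin 4 // q.1 < q.2}, e q x V) ^ 2) := by ring
      _ ≤ T.card * (K ^ 2 * (6 * ∑ q : {q : Fin 4 × Fin 4 // q.1 < q.2}, e q x V ^ 2)) := by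
          refine mul_le_mul_of_nonneg_left ?_ (Nat.cast_nonneg _)
          exact mul_le_mul hΔ h2 (sq_nonneg _) (sq_nonneg _)
      _ = 6 * T.card * K ^ 2 * ∑ q : {q : Fin 4 × Fin 4 // q.1 < q.2}, e q x V ^ 2 := by ring
  -- (3) the per-site mean-square laws, term by term (non-electric terms vanish)
  have hterm2 : ∀ x ∈ T, ∀ q : {q : Fin 4 × Fin 4 // q.1 < q.2},
      torusE G r β L (fun V => e q x V ^ 2) ≤ h ^ 2 := by
    intro x hx q
    obtain ⟨hxc, hxv⟩ := Finset.mem_filter.1 hx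
    by_cases hq : q.1.1 = 0
    · have hfun : (fun V => e q x V ^ 2) = fun V => (kerE G r β c b V (plane G r q.1 x) - pq q) ^ 2 := by
        funext V; simp only [he]; rw [if_pos hq]
      rw [hfun]
      exact hBL2 q hq x hxc hxv
    · have hfun : (fun V => e q x V ^ 2) = fun _ => (0 : ℝ) ^ 2 := by
        funext V; simp only [he]; rw [if_neg hq]
      rw [hfun]
      exact torusE_sq_le_of_abs_le G r β L (Φ := fun _ : LGConfig 4 G => (0 : ℝ)) continuous_const
        fun _ => by rw [abs_zero]; exact hh
  -- (4) integrate
  have hDc : Continuous fun V => ∑ x ∈ T, (v (s • siteToE (x + Pi.single 0 1)) - v (s • siteToE x)) *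
      ∑ q : {q : Fin 4 × Fin 4 // q.1 < q.2}, e q x V :=
    continuous_finsetSum _ fun x _ => continuous_const.mul (continuous_finsetSum _ fun q _ => hec q x)
  have hRc : Continuous fun V => 6 * (T.card : ℝ) * K ^ 2 *
      ∑ x ∈ T, ∑ q : {q : Fin 4 × Fin 4 // q.1 < q.2}, e q x V ^ 2 :=
    continuous_const.mul (continuous_finsetSum _ fun x _ => continuous_finsetSum _ fun q _ => (hec q x).pow 2)
  have hfun : (fun V => (kerE G r β c b V (fun V => ∑ x ∈ cubeSites c b, v (s • siteToE x) *
          ∑ q : {q : Fin 4 × Fin 4 // q.1 < q.2}, plane G r q.1 (if q.1.1 = 0 then x - Pi.single 0 1 else x) V) -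
        kerE G r β c b V (fun V => ∑ y ∈ cubeSites c b, v (s • siteToE y) * dens G r y V) -
        ∑ x ∈ cubeSites c b, (v (s • siteToE (x + Pi.single 0 1)) - v (s • siteToE x)) *
          ∑ q : {q : Fin 4 × Fin 4 // q.1 < q.2}, (if q.1.1 = 0 then pq q else 0)) ^ 2) =
      fun V => (∑ x ∈ T, (v (s • siteToE (x + Pi.single 0 1)) - v (s • siteToE x)) *
        ∑ q : {q : Fin 4 × Fin 4 // q.1 < q.2}, e q x V) ^ 2 := by
    funext V; rw [hD V]
  rw [hfun]
  have hmono := torusE_mono G r β L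
    (A := fun V => (∑ x ∈ T, (v (s • siteToE (x + Pi.single 0 1)) - v (s • siteToE x)) *
        ∑ q : {q : Fin 4 × Fin 4 // q.1 < q.2}, e q x V) ^ 2)
    (B := fun V => 6 * (T.card : ℝ) * K ^ 2 *
      ∑ x ∈ T, ∑ q : {q : Fin 4 × Fin 4 // q.1 < q.2}, e q x V ^ 2) (hDc.pow 2) hRc hpt
  refine hmono.trans ?_
  have hlin : torusE G r β L (fun V => ∑ x ∈ T, ∑ q : {q : Fin 4 × Fin 4 // q.1 < q.2}, e q x V ^ 2) =
      ∑ x ∈ T, ∑ q : {q : Fin 4 × Fin 4 // q.1 < q.2}, torusE G r β L (fun V => e q x V ^ 2) := by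
    rw [torusE_finset_sum G r β L T (fun x V => ∑ q : {q : Fin 4 × Fin 4 // q.1 < q.2}, e q x V ^ 2)
      (fun x _ => continuous_finsetSum _ fun q _ => (hec q x).pow 2)]
    refine Finset.sum_congr rfl fun x _ => ?_
    exact torusE_finset_sum G r β L _ (fun q V => e q x V ^ 2) (fun q _ => (hec q x).pow 2)
  have hTN : (T.card : ℝ) ≤ N := by exact_mod_cast hN
  rw [torusE_const_mul, hlin]
  calc 6 * (T.card : ℝ) * K ^ 2 * ∑ x ∈ T, ∑ q : {q : Fin 4 × Fin 4 // q.1 < q.2},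
        torusE G r β L (fun V => e q x V ^ 2)
      ≤ 6 * (T.card : ℝ) * K ^ 2 * ∑ x ∈ T, ∑ _q : {q : Fin 4 × Fin 4 // q.1 < q.2}, h ^ 2 := by
        refine mul_le_mul_of_nonneg_left ?_ (by positivity)
        exact Finset.sum_le_sum fun x hx => Finset.sum_le_sum fun q _ => hterm2 x hx q
    _ = 36 * (T.card : ℝ) ^ 2 * K ^ 2 * h ^ 2 := by
        simp only [Finset.sum_const, Finset.card_univ, nsmul_eq_mul, hcard6]
        ring
    _ ≤ 36 * (N : ℝ) ^ 2 * K ^ 2 * h ^ 2 := by gcongr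
    _ = (N * (K * (6 * h))) ^ 2 := by ring

end DefectSq

end Summit.QuantumFields.YangMills.Cruxes.NT.MarkovMirror

end
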